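import Literature.NumberTheory.EllipticCurves.GreenbergVatsal2000.CongruentCurves
import HarnessLib

/-!
# Emerton–Pollack–Weston 2006, Theorem 1 (analytic half): `μ^an = 0` passes between elliptic curves
# good ordinary at `p ≥ 5` with isomorphic irreducible `p`-torsion (named fact)

Topic `NumberTheory/EllipticCurves`, sub-directory `EmertonPollackWeston2006` (author–year; namespace
= path, `Literature.NumberTheory.EllipticCurves.EmertonPollackWeston2006`). ONE named fact
(`def … : Prop`, D-0014, nothing asserted) and one proved bookkeeping theorem (the transfer is
symmetric in the pair).

Written by the literature seat of the residual cell `b2b-bsdres`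
(run/shared/lean/b2b/bsd-rank1-residual/; HONEST FRAMING, verbatim: the goal of the cell is to DELETE
the COMBINATION-SHAPED residual classes of the rank-`≤ 1` BSD formula for elliptic curves over `ℚ`
STRICTLY from published theorems, so that the remainder becomes exactly the CONSTRUCTION-SHAPED
classes, which are TYPED, not attempted; this is not "finishing BSD"). This file is the
`Literature/` home of the named fact that the X9 lineage stated inline on the Summits side
(`Summit.BirchSwinnertonDyer.Rank1Residual.X9.thm1_muAn_transfer_of_torsionIso`, file
`Summits/BirchSwinnertonDyer/Rank1Residual/X9/HessePartnerMuTransfer.lean`, whose cite block already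
names this module by a `[file …]` tag): referee A of the cell, ruling R145.2 (R-X9-EPW-SIDE,
2026-08-21), admitted the statement ON CONTENT (page-checked) but MISFILED — named facts live under
`Literature/` — and asked for exactly this file, carrying the SAME statement and cite block; the
Summits-side consumers (`…_of_muTransfer_…`, records `129472bb1` / `129472do1`) are re-pointed by
their owner. The Lean statement below is byte-for-byte the X9 statement (so the Summits `def` can
become an `abbrev` of this one).

## The printed statement and the normalisation it is read in

M. Emerton, R. Pollack, T. Weston, *Variation of Iwasawa invariants in Hida families*, Invent. Math.
163 (2006) 523–580 = arXiv:math/0404484 (held store text `paper:arxiv-math_0404484`; read by this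
seat 2026-08-21, chunk and line locators of that materialisation):

* Intro, chunk p0002 L3–L13: "Let `ρ̄ : G_ℚ → GL₂(k)` be an absolutely irreducible modular Galois
  representation over a finite field `k` of characteristic `p`. Assume further that `ρ̄` is
  `p`-ordinary and `p`-distinguished in the sense that the restriction of `ρ̄` to a decomposition
  group at `p` is reducible and non-scalar. The Hida family `H(ρ̄)` of `ρ̄` is the set of all
  `p`-ordinary `p`-stabilized newforms `f` with mod `p` Galois representation isomorphic to `ρ̄`."
  L19–L28: "To each modular form `f ∈ H(ρ̄)` one may associate the Iwasawa invariants `μ^an(f)`,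
  `λ^an(f)`, `μ^alg(f)`, and `λ^alg(f)` … the `μ`-invariants are the exponents of the powers of `p`
  dividing [the `p`-adic `L`-function, resp. the characteristic power series of the dual of the
  Selmer group]."
* **Theorem 1** (chunk p0002 L33–L37, verbatim): "Fix `∗ ∈ {alg, an}`. If `μ^∗(f₀) = 0` for some
  `f₀ ∈ H(ρ̄)`, then `μ^∗(f) = 0` for all `f ∈ H(ρ̄)`. (We then write simply `μ^∗(ρ̄) = 0`.)"
* The analytic `p`-adic `L`-functions of EPW are "computed with respect to a canonical period"
  (Prop. 4.1.4, chunk p0021 L20–L32 and L95–L113), and Example 5.3.2 (chunk p0033 L16–L28) applies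
  the theory to the pair of elliptic curves of conductors `52`, `364` congruent mod `5` of
  Greenberg–Vatsal.

TRANSCRIPTION (`∗ = an`): `W₁, W₂/ℚ` globally minimal, `5 ≤ p`, both GOOD ORDINARY at `p` (then their
weight-two newforms have `p`-stabilizations in `H(ρ̄)`), a `Γ_ℚ`-equivariant additive isomorphism
`W₁[p] ≃ W₂[p]` and `W₁[p]` irreducible (so `ρ̄` is absolutely irreducible — an odd irreducible
two-dimensional representation in odd characteristic — and `p`-distinguished: ordinary at `p` with
`ω ≠ 1` on inertia since `p ≥ 3`); HYPOTHESIS "`μ^an(f₁) = 0`" and CONCLUSION "`μ^an(f₂) = 0`", both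
spelled in the cell's Néron normalisation — some coefficient of `ϖ·L_p(f, α)` (`ϖ·Ω_W = Ω⁺_f`, `α`
the unit root) is a `p`-adic unit. EPW's canonical-period `μ^an` agrees with this one for
irreducible `E[p]` at odd `p` of good ordinary reduction by Greenberg–Vatsal, Invent. Math. 142
(2000) §3: Prop. (3.1) (optimal curve, "all odd primes `p` of either good or multiplicative
reduction": `Ω_E^α` and `(−2πi)^? Ω_f^α` "are equal up to a factor which is a `p`-adic unit"),
Remark (3.4) ("If `E` does not admit any `p`-isogenies, so that `E[p]` is irreducible, then … the
Néron periods of any isogenous curve differ from those of `E` by a `p`-adic unit. Thus in this case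
we obtain `Ω_E^α = Ω_f^α`, for any choice of sign"), Lemma (3.6), Prop. (3.7) — read on the cell's
decode of the held dvips text `paper:arxiv-math_9906215`
(`run/shared/lean/b2b/bsd-rank1-residual/b2b-bsdres-lit/u1/gv2000_decoded.txt` l.122, l.128,
l.130–132 = arXiv pp. 34–39); this is the SAME reading as the tree's
`GreenbergVatsal2000.thm14_mainConjecture_transfer_of_torsionIso` and
`EmertonPollackWeston2006.cor514_transfer_of_goodOrdinary` (cell registry A28 / A39, both PUB of
record). Registry flags carried (referee A R145): `EPW-Thm1-canonical-vs-Neron-via-GV§3` (composed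
citation), and — until the Summits-side `def` is reduced to an `abbrev` of this one —
`summits-side-named-fact` on that copy.

Weaker than print, never stronger: two weight-two members only, `5 ≤ p` (print: any `p` with `ρ̄`
`p`-distinguished), good ordinary at `p` for both (print allows `p` in the level), `∗ = an` only.
No `_holds` (size XL: Hida theory for `ρ̄`, two-variable `p`-adic `L`-functions, EPW §§2–4).

## References

* M. Emerton, R. Pollack, T. Weston, Invent. Math. 163 (2006) 523–580, Thm. 1 (p. 524 = arXiv p. 2),
  §3.1, Prop. 4.1.4, Ex. 5.3.2. [EmertonPollackWeston2006]
* R. Greenberg, V. Vatsal, Invent. Math. 142 (2000) 17–63, §3: Prop. (3.1), Remark (3.4),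
  Lemma (3.6), Prop. (3.7). [GreenbergVatsal2000]
-/

set_option autoImplicit false

noncomputable section

open scoped Classical MatrixGroups ModularForm

open CongruenceSubgroup WeierstrassCurve Literature.NumberTheory.EllipticCurves
  Literature.NumberTheory.EllipticCurves.ModularForms Literature.NumberTheory.EllipticCurves.Rank1Residual
  Literature.NumberTheory.EllipticCurves.GreenbergVatsal2000

namespace Literature.NumberTheory.EllipticCurves.EmertonPollackWeston2006

/-- **Emerton–Pollack–Weston 2006, Theorem 1 (analytic half), for two elliptic curves good ordinary
at `p ≥ 5` with isomorphic irreducible `p`-torsion.** M. Emerton, R. Pollack, T. Weston, *Variation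
of Iwasawa invariants in Hida families*, Invent. Math. 163 (2006) 523–580 = arXiv:math/0404484,
Theorem 1 (p. 2; held text chunk p0002 L33–L37): "Fix `∗ ∈ {alg, an}`. If `μ^∗(f₀) = 0` for some
`f₀ ∈ H(ρ̄)`, then `μ^∗(f) = 0` for all `f ∈ H(ρ̄)`", where (pp. 1–2, chunk p0002 L3–L13)
"`ρ̄ : G_ℚ → GL₂(k)` [is] an absolutely irreducible modular Galois representation over a finite field
`k` of characteristic `p` … `p`-ordinary and `p`-distinguished" and "the Hida family `H(ρ̄)` of `ρ̄`
is the set of all `p`-ordinary `p`-stabilized newforms `f` with mod `p` Galois representation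
isomorphic to `ρ̄`"; `μ^an(f)` is "the exponent of the power of `p` dividing" the `p`-adic
`L`-function of `f` (p. 2; §3–§4 for the normalisation by canonical periods, Prop. 4.1.4).
TRANSCRIPTION (`∗ = an`): `W₁, W₂/ℚ` globally minimal elliptic curves, `5 ≤ p`, both GOOD ORDINARY
at `p` (`HasGoodReductionAtPrime`, `p ∤ a_p`: then the weight-two newforms `f₁`, `f₂` have
`p`-stabilizations in `H(ρ̄)`), a `Γ_ℚ`-equivariant additive isomorphism `W₁[p] ≃ W₂[p]` and
`W₁[p]` irreducible (so `ρ̄` is absolutely irreducible and `p`-distinguished: irreducible odd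
two-dimensional; ordinary at `p` with `ω ≠ 1` on inertia since `p ≥ 5`); HYPOTHESIS
"`μ^an(f₁) = 0`" and CONCLUSION "`μ^an(f₂) = 0`", both spelled in the cell's Néron normalisation —
some coefficient of `ϖ·L_p(f, α)` (`ϖ·Ω_W = Ω⁺_f`, `α` the unit root) is a `p`-adic unit
(`GreenbergVatsal2000.hasUnitContent_iff_exists_norm_coeff_map_eq_one`); EPW's canonical-period
`μ^an` agrees with this one for irreducible `E[p]` by Greenberg–Vatsal 2000 §3 (Prop. (3.1),
Remark (3.4), Lemma (3.6), Prop. (3.7)) — the reading already used by the tree's Greenberg–Vatsal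
Thm. (1.4) record (file `GreenbergVatsal2000/CongruentCurves.lean`) and by
`EmertonPollackWeston2006.cor514_transfer_of_goodOrdinary`. The statement is byte-identical to the
Summits-side `Summit.BirchSwinnertonDyer.Rank1Residual.X9.thm1_muAn_transfer_of_torsionIso`
(X9 lineage, 2026-08-21), relocated here per the cell referee's ruling R145.2. Named fact; nothing
asserted; users take `(h : thm1_muAn_transfer_of_torsionIso)`.
-- TODO(general form): Theorem 1 for every pair of members of H(ρ̄) (all weights, twists ω^i, p in the level), and ∗ = alg.
[cite: EmertonPollackWeston2006, Thm. 1 (arXiv:math/0404484 p. 2, held text `paper:arxiv-math_0404484` chunk p0002 L33–L37), Intro pp. 1–2 (H(ρ̄), chunk p0002 L3–L13), Prop. 4.1.4 (canonical periods), Ex. 5.3.2]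
[cite: GreenbergVatsal2000, §3, Prop. (3.1), Remark (3.4), Lemma (3.6), Prop. (3.7) (arXiv:math/9906215 pp. 34–39)] -/
def thm1_muAn_transfer_of_torsionIso : Prop :=
  ∀ (W₁ W₂ : WeierstrassCurve ℚ) [W₁.IsElliptic] [W₁.IsGloballyMinimal]
    [W₂.IsElliptic] [W₂.IsGloballyMinimal] (p : ℕ) [Fact p.Prime],
    5 ≤ p →
    W₁.HasGoodReductionAtPrime p → ¬ (p : ℤ) ∣ W₁.frobeniusTrace p →
    W₂.HasGoodReductionAtPrime p → ¬ (p : ℤ) ∣ W₂.frobeniusTrace p →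
    (∃ e : geomTorsion W₁ (p : ℤ) ≃+ geomTorsion W₂ (p : ℤ),
      ∀ (σ : Field.absoluteGaloisGroup ℚ) (P : geomTorsion W₁ (p : ℤ)), e (σ • P) = σ • e P) →
    W₁.HasIrreducibleModPGaloisRep p →
    (∀ [NeZero (W₁.conductorNorm ℤ)] (f₁ : CuspForm (Gamma0 (W₁.conductorNorm ℤ)) 2),
        IsNewformOf W₁ f₁ → ∀ (ϖ₁ : ℚ), (ϖ₁ : ℝ) * W₁.realPeriodRat = plusPeriod f₁ →
      ∃ n : ℕ, ‖PowerSeries.coeff n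
        (PowerSeries.C (ϖ₁ : ℚ_[p]) * padicLFunction f₁ (unitRoot W₁ p : ℚ_[p]))‖ = 1) →
    ∀ [NeZero (W₂.conductorNorm ℤ)] (f₂ : CuspForm (Gamma0 (W₂.conductorNorm ℤ)) 2),
        IsNewformOf W₂ f₂ → ∀ (ϖ₂ : ℚ), (ϖ₂ : ℝ) * W₂.realPeriodRat = plusPeriod f₂ →
      ∃ n : ℕ, ‖PowerSeries.coeff n
        (PowerSeries.C (ϖ₂ : ℚ_[p]) * padicLFunction f₂ (unitRoot W₂ p : ℚ_[p]))‖ = 1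

/-- **The transfer is symmetric in the pair.** The printed theorem is a statement about the whole
Hida family `H(ρ̄)`; the transcription fixes a direction `W₁ → W₂` and puts the irreducibility
hypothesis on `W₁[p]`. Along the inverse of the given equivariant isomorphism the same fact yields the
direction `W₂ → W₁`, the irreducibility of `W₂[p]` being that of `W₁[p]` transported
(`GreenbergVatsal2000.hasIrreducibleModPGaloisRep_of_torsionIso`). Bookkeeping only.
[cite: EmertonPollackWeston2006, Thm. 1 (arXiv:math/0404484 p. 2)] -/
theorem thm1_muAn_transfer_of_torsionIso.symm (h : thm1_muAn_transfer_of_torsionIso)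
    (W₁ W₂ : WeierstrassCurve ℚ) [W₁.IsElliptic] [W₁.IsGloballyMinimal]
    [W₂.IsElliptic] [W₂.IsGloballyMinimal] (p : ℕ) [Fact p.Prime] (hp : 5 ≤ p)
    (hgood₁ : W₁.HasGoodReductionAtPrime p) (hord₁ : ¬ (p : ℤ) ∣ W₁.frobeniusTrace p)
    (hgood₂ : W₂.HasGoodReductionAtPrime p) (hord₂ : ¬ (p : ℤ) ∣ W₂.frobeniusTrace p)
    (hiso : ∃ e : geomTorsion W₁ (p : ℤ) ≃+ geomTorsion W₂ (p : ℤ),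
      ∀ (σ : Field.absoluteGaloisGroup ℚ) (P : geomTorsion W₁ (p : ℤ)), e (σ • P) = σ • e P)
    (hirr₁ : W₁.HasIrreducibleModPGaloisRep p)
    (hμ₂ : ∀ [NeZero (W₂.conductorNorm ℤ)] (f₂ : CuspForm (Gamma0 (W₂.conductorNorm ℤ)) 2),
        IsNewformOf W₂ f₂ → ∀ (ϖ₂ : ℚ), (ϖ₂ : ℝ) * W₂.realPeriodRat = plusPeriod f₂ →
      ∃ n : ℕ, ‖PowerSeries.coeff n
        (PowerSeries.C (ϖ₂ : ℚ_[p]) * padicLFunction f₂ (unitRoot W₂ p : ℚ_[p]))‖ = 1)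
    [NeZero (W₁.conductorNorm ℤ)] (f₁ : CuspForm (Gamma0 (W₁.conductorNorm ℤ)) 2)
    (hf₁ : IsNewformOf W₁ f₁) (ϖ₁ : ℚ) (hϖ₁ : (ϖ₁ : ℝ) * W₁.realPeriodRat = plusPeriod f₁) :
    ∃ n : ℕ, ‖PowerSeries.coeff n
        (PowerSeries.C (ϖ₁ : ℚ_[p]) * padicLFunction f₁ (unitRoot W₁ p : ℚ_[p]))‖ = 1 := by
  obtain ⟨e, he⟩ := hiso
  have hirr₂ : W₂.HasIrreducibleModPGaloisRep p :=
    hasIrreducibleModPGaloisRep_of_torsionIso e he hirr₁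
  -- the inverse isomorphism is equivariant as well
  have he' : ∀ (σ : Field.absoluteGaloisGroup ℚ) (Q : geomTorsion W₂ (p : ℤ)),
      e.symm (σ • Q) = σ • e.symm Q := by
    intro σ Q
    apply e.injective
    rw [e.apply_symm_apply, he, e.apply_symm_apply]
  exact h W₂ W₁ p hp hgood₂ hord₂ hgood₁ hord₁ ⟨e.symm, he'⟩ hirr₂ hμ₂ f₁ hf₁ ϖ₁ hϖ₁


/-! ### Theorem 1 at every ODD prime (print strength; appended 2026-08-26, cell `b2b-bsdres` x10 GEN 37) -/

/-- **Emerton–Pollack–Weston 2006, Theorem 1 (analytic half), for two elliptic curves good ordinary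
at an ODD prime `p` with isomorphic irreducible `p`-torsion.** The printed hypotheses (arXiv:math/0404484):
"We fix an odd prime `p`" (§1, Notation, p. 5); `ρ̄` "irreducible, odd, ordinary and `p`-distinguished"
(§2.6, p. 13), `p`-distinguished meaning that "the characters `χ` and `ψ` [of the ordinary filtration of
`ρ̄|_{G_p}`] are distinct" (§2.6); Theorem 1 (p. 2): "Fix `∗ ∈ {alg, an}`. If `μ^∗(f₀) = 0` for some
`f₀ ∈ H(ρ̄)`, then `μ^∗(f) = 0` for all `f ∈ H(ρ̄)`." For a globally minimal elliptic curve with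
good ORDINARY reduction at an odd prime `p` the residual representation is `p`-distinguished at EVERY
odd `p`: on the inertia group at `p` the two diagonal characters are `ω` (the mod-`p` cyclotomic
character, of order `p − 1 ≥ 2` on inertia) and the trivial character. TRANSCRIPTION (`∗ = an`):
VERBATIM `thm1_muAn_transfer_of_torsionIso` above with its `5 ≤ p` replaced by `p ≠ 2` — the
`5 ≤ p` of the earlier transcription ("`ω ≠ 1` on inertia since `p ≥ 5`") was weaker than print for no
reason in print; this declaration is the print-strength form and implies the earlier one
(`thm1_muAn_transfer_of_torsionIso_of_odd`). Same Néron normalisation of `μ^an = 0` (a `p`-adic unit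
coefficient of `ϖ·L_p(f, α)`, `ϖ·Ω_W = Ω⁺_f`), agreeing with EPW's canonical-period `μ^an` for
irreducible `E[p]` by Greenberg–Vatsal 2000 §3 (Prop. (3.7) is printed for odd `p`). Weaker than print
(two weight-2 members of `H(ρ̄)` only), never stronger. Named fact; nothing asserted; users take
`(h : thm1_muAn_transfer_of_torsionIso_odd)`. Consumer: the class-X10b (`p = 3`) `ρ̄`-invariance of the
analytic `μ = 0` certificate, `Summits/BirchSwinnertonDyer/Rank1Residual/X10/AnalyticMuZeroThreeRhoBarInvariance.lean`
(which carries a Summits-side copy of this statement, `Summit.BirchSwinnertonDyer.Rank1Residual.X10.thm1_muAn_transfer_of_torsionIso_odd`,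
p442790, to be re-pointed here).
-- TODO(general form): Theorem 1 for every pair of members of H(ρ̄) (all weights, twists ω^i, p in the level), and ∗ = alg.
[cite: EmertonPollackWeston2006, Thm. 1 (arXiv:math/0404484 p. 2), §1 Notation (p. 5, "We fix an odd prime p"), §2.6 (p. 13, p-distinguished), Prop. 4.1.4 (canonical periods)]
[cite: GreenbergVatsal2000, §3, Prop. (3.1), Remark (3.4), Lemma (3.6), Prop. (3.7) (arXiv:math/9906215 pp. 34–39)] -/
def thm1_muAn_transfer_of_torsionIso_odd : Prop :=
  ∀ (W₁ W₂ : WeierstrassCurve ℚ) [W₁.IsElliptic] [W₁.IsGloballyMinimal]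
    [W₂.IsElliptic] [W₂.IsGloballyMinimal] (p : ℕ) [Fact p.Prime],
    p ≠ 2 →
    W₁.HasGoodReductionAtPrime p → ¬ (p : ℤ) ∣ W₁.frobeniusTrace p →
    W₂.HasGoodReductionAtPrime p → ¬ (p : ℤ) ∣ W₂.frobeniusTrace p →
    (∃ e : geomTorsion W₁ (p : ℤ) ≃+ geomTorsion W₂ (p : ℤ),
      ∀ (σ : Field.absoluteGaloisGroup ℚ) (P : geomTorsion W₁ (p : ℤ)), e (σ • P) = σ • e P) →
    W₁.HasIrreducibleModPGaloisRep p →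
    (∀ [NeZero (W₁.conductorNorm ℤ)] (f₁ : CuspForm (Gamma0 (W₁.conductorNorm ℤ)) 2),
        IsNewformOf W₁ f₁ → ∀ (ϖ₁ : ℚ), (ϖ₁ : ℝ) * W₁.realPeriodRat = plusPeriod f₁ →
      ∃ n : ℕ, ‖PowerSeries.coeff n
        (PowerSeries.C (ϖ₁ : ℚ_[p]) * padicLFunction f₁ (unitRoot W₁ p : ℚ_[p]))‖ = 1) →
    ∀ [NeZero (W₂.conductorNorm ℤ)] (f₂ : CuspForm (Gamma0 (W₂.conductorNorm ℤ)) 2),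
        IsNewformOf W₂ f₂ → ∀ (ϖ₂ : ℚ), (ϖ₂ : ℝ) * W₂.realPeriodRat = plusPeriod f₂ →
      ∃ n : ℕ, ‖PowerSeries.coeff n
        (PowerSeries.C (ϖ₂ : ℚ_[p]) * padicLFunction f₂ (unitRoot W₂ p : ℚ_[p]))‖ = 1

/-- **The odd-prime transcription implies the `5 ≤ p` one** (bookkeeping: `5 ≤ p ⟹ p ≠ 2`).
[cite: EmertonPollackWeston2006, Thm. 1 (arXiv:math/0404484 p. 2)] -/
theorem thm1_muAn_transfer_of_torsionIso_of_odd (h : thm1_muAn_transfer_of_torsionIso_odd) :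
    thm1_muAn_transfer_of_torsionIso := by
  intro W₁ W₂ _ _ _ _ p _ hp5
  exact h W₁ W₂ p (by omega)

/-- **The odd-prime transfer is symmetric in the pair** (as `thm1_muAn_transfer_of_torsionIso.symm`:
the inverse isomorphism is equivariant and irreducibility transports).
[cite: EmertonPollackWeston2006, Thm. 1 (arXiv:math/0404484 p. 2)] -/
theorem thm1_muAn_transfer_of_torsionIso_odd.symm (h : thm1_muAn_transfer_of_torsionIso_odd)
    (W₁ W₂ : WeierstrassCurve ℚ) [W₁.IsElliptic] [W₁.IsGloballyMinimal]
    [W₂.IsElliptic] [W₂.IsGloballyMinimal] (p : ℕ) [Fact p.Prime] (hp : p ≠ 2)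
    (hgood₁ : W₁.HasGoodReductionAtPrime p) (hord₁ : ¬ (p : ℤ) ∣ W₁.frobeniusTrace p)
    (hgood₂ : W₂.HasGoodReductionAtPrime p) (hord₂ : ¬ (p : ℤ) ∣ W₂.frobeniusTrace p)
    (hiso : ∃ e : geomTorsion W₁ (p : ℤ) ≃+ geomTorsion W₂ (p : ℤ),
      ∀ (σ : Field.absoluteGaloisGroup ℚ) (P : geomTorsion W₁ (p : ℤ)), e (σ • P) = σ • e P)
    (hirr₁ : W₁.HasIrreducibleModPGaloisRep p)
    (hμ₂ : ∀ [NeZero (W₂.conductorNorm ℤ)] (f₂ : CuspForm (Gamma0 (W₂.conductorNorm ℤ)) 2),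
        IsNewformOf W₂ f₂ → ∀ (ϖ₂ : ℚ), (ϖ₂ : ℝ) * W₂.realPeriodRat = plusPeriod f₂ →
      ∃ n : ℕ, ‖PowerSeries.coeff n
        (PowerSeries.C (ϖ₂ : ℚ_[p]) * padicLFunction f₂ (unitRoot W₂ p : ℚ_[p]))‖ = 1)
    [NeZero (W₁.conductorNorm ℤ)] (f₁ : CuspForm (Gamma0 (W₁.conductorNorm ℤ)) 2)
    (hf₁ : IsNewformOf W₁ f₁) (ϖ₁ : ℚ) (hϖ₁ : (ϖ₁ : ℝ) * W₁.realPeriodRat = plusPeriod f₁) :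
    ∃ n : ℕ, ‖PowerSeries.coeff n
        (PowerSeries.C (ϖ₁ : ℚ_[p]) * padicLFunction f₁ (unitRoot W₁ p : ℚ_[p]))‖ = 1 := by
  obtain ⟨e, he⟩ := hiso
  have hirr₂ : W₂.HasIrreducibleModPGaloisRep p :=
    hasIrreducibleModPGaloisRep_of_torsionIso e he hirr₁
  have he' : ∀ (σ : Field.absoluteGaloisGroup ℚ) (Q : geomTorsion W₂ (p : ℤ)),
      e.symm (σ • Q) = σ • e.symm Q := by
    intro σ Q
    apply e.injective
    rw [e.apply_symm_apply, he, e.apply_symm_apply]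
  exact h W₂ W₁ p hp hgood₂ hord₂ hgood₁ hord₁ ⟨e.symm, he'⟩ hirr₂ hμ₂ f₁ hf₁ ϖ₁ hϖ₁

end Literature.NumberTheory.EllipticCurves.EmertonPollackWeston2006

end
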